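import Literature.Probability.RandomPlanarGeometry.HexSAWSurfaceWallRenewalSlackFourFourDownLaw
import Literature.Probability.RandomPlanarGeometry.HexSAWSurfaceWallRenewalSlackTwoClassification
import Literature.Probability.RandomPlanarGeometry.HexSAWSurfaceWallRenewalSixStepRigid
import Literature.Probability.RandomPlanarGeometry.HexSAWSurfaceWallRenewalTenThree
import Literature.Combinatorics.Enumerative.PolynomialSequenceGeneratingFunction
import HarnessLib

/-!
# Hexagonal-lattice SAWs at a surface: the slack diagonals of the renewal table are rational — `D₀`, `D₁`, `D₂` in closed form

Irreducible positive wall bridges (`ipwb m`, the wall-renewal blocks of the brick-wall = hexagonal half-plane walk;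
`visits m ω` = number of surface visits) satisfy the six-step law `6·visits ≤ m` for `m ≥ 4`
(`…SixStepRigid`), so the two-variable renewal table `N(m, v) = #{ω ∈ ipwb m : visits = v}` lives on the SLACK
DIAGONALS `m = 6k + 2j` (`j = 0, 1, 2, …`; the atom of length two is the only block off them). This module packages
the three exact diagonal laws of the lineage as identities of integer formal power series
`D_j := Σ_k N(6k + 2j, k) X^k ∈ ℤ⟦X⟧` (`slackDiagSeries j`, coefficients `slackDiagCount j k`):

* `one_sub_X_mul_slackDiagSeries_zero` — `(1 − X) · D₀ = X`, i.e. `D₀ = X/(1 − X)`: one block per length on the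
  tight diagonal (`card_filter_six_mul_visits_eq`, `…SixStepRigid`).

* `one_sub_X_pow_four_mul_slackDiagSeries_one` — `(1 − X)⁴ · D₁ = X − X² + X³ + 2X⁴ − X⁵`: the slack-two law
  `N(6k+2, k) = 2 + Σ_{i<k} i²` (`k ≥ 2`, `card_filter_visits_eq_slack_two`, `…SlackTwoClassification`) together with
  `N(8, 1) = 1` (`card_ipwb_eight_eq_one`); a cubic in `k`, so a pole of order four at `X = 1` and nothing else.

* `one_sub_X_pow_six_mul_slackDiagSeries_two` — ★ `(1 − X)⁶ · D₂ = 3X − 7X² + 12X³ + 2X⁴ + 10X⁵ + X⁶ − X⁷`: the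
  slack-four law `12·N(6k+4, k) = 2k⁵ − 11k⁴ + 30k³ + 5k² − 38k + 60` (`k ≥ 2`,
  `twelve_mul_card_filter_visits_slack_four`, `…SlackFourFourDownLaw`) together with `N(10, 1) = 3`
  (`card_ipwb_ten_eq_three`); a quintic in `k`, so a pole of order six at `X = 1` and nothing else
  (numerator value `20 = 5!·(2/12)` at `X = 1`).

* `slackDiagSeries_zero_eq`, `slackDiagSeries_one_eq`, `slackDiagSeries_two_eq` — the same three laws solved for
  `D_j`: `D_j = (1 + X + X² + ⋯)^{2j+2∨1} · (numerator)` with `PowerSeries.mk 1 = Σ X^n = (1 − X)⁻¹`.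

* `isPolySeqOfDegree_slackDiagCount_zero_succ`, `isPolySeqOfDegree_slackDiagCount_one_add_two`,
  `isPolySeqOfDegree_slackDiagCount_two_add_two` — DIAGONAL POLYNOMIALITY for `j = 0, 1, 2` in the vocabulary of
  `Literature.Combinatorics.Enumerative.PolynomialSequenceGeneratingFunction` (Kauers–Paule, Sect. 3.2): past its initial
  defect (`k ≥ 1`, resp. `k ≥ 2`, `k ≥ 2`) the `j`-th diagonal is a polynomial sequence over `ℚ` of degree EXACTLY
  `0`, `3`, `5` (`= 2j + 1` for `j = 1, 2`), so `kp_thm_3_1` there applies to the shifted diagonals.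

Method: `(1 − X)^j · mk d = mk (Δ^j d)` for the backward difference `Δ` (`bdiff_dg`), the vanishing of the
`(deg + 1)`-st difference of a polynomial sequence beyond the initial window (`ring` / `linear_combination` on the
closed forms), and the finitely many initial coefficients from the small censuses (`visits ≥ 1`, `N(8,1) = 1`,
`N(10,1) = 3`).

STATUS: lane theorems of the a-idea-1 bridge/renewal lineage, car 102 «the diagonal series» — the "explicit rates"
packaging of FINDING-HEX-WALL-SLACK-FOUR-LAW §4 (diagonal polynomiality for `j ≤ 2`: `D_j` is rational with its only
pole at `X = 1`, of order `2j + 2` for `j = 1, 2`). OURS (elementary). Sources: the renewal /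
irreducible-bridge structure [MS] Madras–Slade §4.2 (Definition 4.2.1, p. 90; (4.2.2); remark before (4.2.21), p. 94),
the critical surface fugacity `1 + √2` of the honeycomb lattice [BBDDG] Beaton–Bousquet-Mélou–de Gier–Duminil-Copin–Guttmann §3.1,
the brick-wall frame [EJ] Enting–Jensen §7.4.2, Fig. 7.10, and for rational diagonal/row generating functions of
lattice-walk tables the kernel-method frame of [BM] Bousquet-Mélou (Discrete Math. 2002) — none states these series.
-/

namespace Literature.Probability.RandomPlanarGeometry.SAW.HexBW.Wall

open Finset Filter Function
open Literature.Probability.LatticeModels Literature.Probability.Percolation SimpleGraph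

variable {ω : ℕ → Site 2}

/-! ## The slack diagonals of the renewal table -/

/-- `N(6k + 2j, k)`: the number of irreducible positive wall bridges of length `6k + 2j` — slack `2j` — with exactly
`k` surface visits; the `k`-th entry of the `j`-th slack diagonal of the surface renewal table. OURS (notation).
[cite: MadrasSlade1993, §4.2, Definition 4.2.1 (p. 90), (4.2.2)] -/
noncomputable def slackDiagCount (j k : ℕ) : ℕ :=
  #((ipwb (6 * k + 2 * j)).filter fun ω => visits (6 * k + 2 * j) ω = k)

/-- The `j`-th slack diagonal of the surface renewal table as an integer formal power series
`D_j = Σ_k N(6k + 2j, k) X^k`. OURS (notation).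
[cite: MadrasSlade1993, §4.2, (4.2.2)] -/
noncomputable def slackDiagSeries (j : ℕ) : PowerSeries ℤ :=
  PowerSeries.mk fun k => (slackDiagCount j k : ℤ)

/-- The coefficient of `X^k` in `D_j` is `N(6k + 2j, k)`. OURS (notation). [cite: MadrasSlade1993, §4.2, (4.2.2)] -/
theorem coeff_slackDiagSeries (j k : ℕ) :
    PowerSeries.coeff k (slackDiagSeries j) = (slackDiagCount j k : ℤ) := by
  rw [slackDiagSeries, PowerSeries.coeff_mk]

/-- A block visits the surface at its last step, so `visits ≥ 1` (plumbing). [folklore] -/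
private theorem one_le_visits_dg {n : ℕ} (hω : ω ∈ ipwb n) : 1 ≤ visits n ω := by
  classical
  obtain ⟨hp, hn1, -⟩ := mem_ipwb.1 hω
  obtain ⟨hw, -⟩ := mem_pwb.1 hp
  obtain ⟨ha, -⟩ := mem_wbr.1 hw
  obtain ⟨-, hn2, hYn⟩ := mem_archs.1 ha
  obtain ⟨k, rfl⟩ : ∃ k, n = k + 1 := ⟨n - 1, by omega⟩
  rw [visits_succ, if_pos ⟨hn2, hYn⟩]
  omega

/-- No block has zero visits: every slack diagonal starts with `N(2j, 0) = 0`. OURS.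
[cite: MadrasSlade1993, §4.2, Definition 4.2.1 (p. 90)] -/
theorem slackDiagCount_zero_right (j : ℕ) : slackDiagCount j 0 = 0 := by
  unfold slackDiagCount
  rw [Finset.card_eq_zero, Finset.filter_eq_empty_iff]
  intro ζ hζ h0
  have h1 := one_le_visits_dg hζ
  omega

/-- The tight diagonal: `N(6k, k) = 1` for `k ≥ 1` (the dip, then the hooks; `card_filter_six_mul_visits_eq`).
[cite: MadrasSlade1993, §4.2, remark before (4.2.21) (p. 94)] -/
theorem slackDiagCount_zero_succ (m : ℕ) : slackDiagCount 0 (m + 1) = 1 := by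
  unfold slackDiagCount
  have h := card_filter_six_mul_visits_eq (n := 6 * (m + 1) + 2 * 0) (by omega)
  rw [if_pos (by omega : 6 ∣ 6 * (m + 1) + 2 * 0)] at h
  have e : (ipwb (6 * (m + 1) + 2 * 0)).filter (fun ζ => visits (6 * (m + 1) + 2 * 0) ζ = m + 1)
      = (ipwb (6 * (m + 1) + 2 * 0)).filter (fun ζ => 6 * visits (6 * (m + 1) + 2 * 0) ζ = 6 * (m + 1) + 2 * 0) :=
    Finset.filter_congr fun ζ _ => ⟨fun h1 => by omega, fun h1 => by omega⟩
  rw [e, h]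

/-- Symbolic length (`m = 8`, never the numeral under `ipwb`): all of `ipwb 8` has one visit, and `#(ipwb 8) = 1`.
[cite: MadrasSlade1993, §4.2, (4.2.2)] -/
private theorem card_filter_visits_eq_one_eight_dg {m : ℕ} (hm : m = 8) :
    #((ipwb m).filter fun ω => visits m ω = 1) = 1 := by
  rw [Finset.filter_true_of_mem fun ζ hζ => visits_eq_one_of_mem_ipwb_eight hm hζ]
  exact card_ipwb_eight_eq_one hm

/-- Symbolic length (`m = 10`): all of `ipwb 10` has one visit, and `#(ipwb 10) = 3`.
[cite: MadrasSlade1993, §4.2, (4.2.2)] -/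
private theorem card_filter_visits_eq_one_ten_dg {m : ℕ} (hm : m = 10) :
    #((ipwb m).filter fun ω => visits m ω = 1) = 3 := by
  rw [Finset.filter_true_of_mem fun ζ hζ => visits_eq_one_of_mem_ipwb_ten hm hζ]
  exact card_ipwb_ten_eq_three hm

/-- `N(8, 1) = 1`: the flat excursion (`card_ipwb_eight_eq_one`, `visits_eq_one_of_mem_ipwb_eight`).
[cite: MadrasSlade1993, §4.2, (4.2.2)] -/
theorem slackDiagCount_one_one : slackDiagCount 1 1 = 1 :=
  card_filter_visits_eq_one_eight_dg (by norm_num)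

/-- The slack-two law on the diagonal: `N(6k+2, k) = 2 + Σ_{i<k} i²` for `k ≥ 2` (`card_filter_visits_eq_slack_two`).
[cite: MadrasSlade1993, §4.2, remark before (4.2.21) (p. 94)] -/
theorem slackDiagCount_one_add_two (m : ℕ) : slackDiagCount 1 (m + 2) = 2 + ∑ i ∈ range (m + 2), i ^ 2 := by
  unfold slackDiagCount
  exact card_filter_visits_eq_slack_two (by omega) (by ring)

/-- `N(10, 1) = 3`: the three blocks of length ten (`card_ipwb_ten_eq_three`, `visits_eq_one_of_mem_ipwb_ten`).
[cite: MadrasSlade1993, §4.2, (4.2.2)] -/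
theorem slackDiagCount_two_one : slackDiagCount 2 1 = 3 :=
  card_filter_visits_eq_one_ten_dg (by norm_num)

/-- The slack-four law on the diagonal, shifted to `k = m + 2` so that no truncated subtraction remains:
`12·N(6(m+2)+4, m+2) = 2m⁵ + 9m⁴ + 22m³ + 81m² + 150m + 132` (`twelve_mul_card_filter_visits_slack_four`).
[cite: MadrasSlade1993, §4.2, remark before (4.2.21) (p. 94)] [cite: EntingJensen2009, §7.4.2, Fig. 7.10] -/
theorem twelve_mul_slackDiagCount_two_add_two (m : ℕ) :
    12 * slackDiagCount 2 (m + 2) = 2 * m ^ 5 + 9 * m ^ 4 + 22 * m ^ 3 + 81 * m ^ 2 + 150 * m + 132 := by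
  unfold slackDiagCount
  rw [twelve_mul_card_filter_visits_slack_four (k := m + 2) (by omega) (by ring)]
  have : 2 * (m + 2) ^ 5 + 30 * (m + 2) ^ 3 + 5 * (m + 2) ^ 2 + 60 =
      11 * (m + 2) ^ 4 + 38 * (m + 2) + (2 * m ^ 5 + 9 * m ^ 4 + 22 * m ^ 3 + 81 * m ^ 2 + 150 * m + 132) := by
    ring
  omega

/-! ## Backward differences and `(1 − X)^j` -/

section Series

open PowerSeries

/-- Backward difference with the convention `d (−1) = 0` (plumbing). [folklore] -/
private def bdiff_dg (d : ℕ → ℤ) (n : ℕ) : ℤ := d n - if n = 0 then 0 else d (n - 1)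

/-- `(1 − X) · Σ d_n X^n = Σ (Δd)_n X^n` (plumbing). [folklore] -/
private theorem one_sub_X_mul_mk_dg (d : ℕ → ℤ) : (1 - X : PowerSeries ℤ) * mk d = mk (bdiff_dg d) := by
  ext n
  rcases n with _ | n
  · simp [bdiff_dg, sub_mul, coeff_zero_eq_constantCoeff]
  · simp [bdiff_dg, sub_mul, coeff_succ_X_mul]

/-- `(1 − X)^j · Σ d_n X^n = Σ (Δ^j d)_n X^n` (plumbing). [folklore] -/
private theorem one_sub_X_pow_mul_mk_dg (d : ℕ → ℤ) (j : ℕ) :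
    (1 - X : PowerSeries ℤ) ^ j * mk d = mk (bdiff_dg^[j] d) := by
  induction j generalizing d with
  | zero => simp
  | succ j ih => rw [pow_succ, mul_assoc, one_sub_X_mul_mk_dg, ih, Function.iterate_succ_apply]

/-- `(Δd)_0 = d_0` (plumbing). [folklore] -/
private theorem bdiff_zero_dg (d : ℕ → ℤ) : bdiff_dg d 0 = d 0 := by simp [bdiff_dg]

/-- `(Δd)_{m+1} = d_{m+1} − d_m` (plumbing). [folklore] -/
private theorem bdiff_succ_dg (d : ℕ → ℤ) (m : ℕ) : bdiff_dg d (m + 1) = d (m + 1) - d m := by simp [bdiff_dg]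

/-- `Δ⁴d` at `n ≤ 5`, binomial signs (plumbing). [folklore] -/
private theorem bdiff_four_small_dg (d : ℕ → ℤ) :
    bdiff_dg^[4] d 0 = d 0 ∧ bdiff_dg^[4] d 1 = d 1 - 4 * d 0 ∧ bdiff_dg^[4] d 2 = d 2 - 4 * d 1 + 6 * d 0 ∧
    bdiff_dg^[4] d 3 = d 3 - 4 * d 2 + 6 * d 1 - 4 * d 0 ∧
    bdiff_dg^[4] d 4 = d 4 - 4 * d 3 + 6 * d 2 - 4 * d 1 + d 0 ∧
    bdiff_dg^[4] d 5 = d 5 - 4 * d 4 + 6 * d 3 - 4 * d 2 + d 1 := by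
  simp only [Function.iterate_succ_apply', Function.iterate_zero_apply, bdiff_dg]
  refine ⟨?_, ?_, ?_, ?_, ?_, ?_⟩ <;> simp <;> ring

/-- `Δ⁴d` at `n = m + 6` (plumbing). [folklore] -/
private theorem bdiff_four_add_six_dg (d : ℕ → ℤ) (m : ℕ) :
    bdiff_dg^[4] d (m + 6) = d (m + 6) - 4 * d (m + 5) + 6 * d (m + 4) - 4 * d (m + 3) + d (m + 2) := by
  simp only [Function.iterate_succ_apply', Function.iterate_zero_apply, bdiff_dg]
  simp only [show m + 6 - 1 = m + 5 by omega, show m + 5 - 1 = m + 4 by omega, show m + 4 - 1 = m + 3 by omega,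
    show m + 3 - 1 = m + 2 by omega, Nat.add_eq_zero_iff, OfNat.ofNat_ne_zero, and_false, if_false]
  ring

/-- `Δ⁶d` at `n ≤ 7`, binomial signs (plumbing). [folklore] -/
private theorem bdiff_six_small_dg (d : ℕ → ℤ) :
    bdiff_dg^[6] d 0 = d 0 ∧ bdiff_dg^[6] d 1 = d 1 - 6 * d 0 ∧ bdiff_dg^[6] d 2 = d 2 - 6 * d 1 + 15 * d 0 ∧
    bdiff_dg^[6] d 3 = d 3 - 6 * d 2 + 15 * d 1 - 20 * d 0 ∧
    bdiff_dg^[6] d 4 = d 4 - 6 * d 3 + 15 * d 2 - 20 * d 1 + 15 * d 0 ∧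
    bdiff_dg^[6] d 5 = d 5 - 6 * d 4 + 15 * d 3 - 20 * d 2 + 15 * d 1 - 6 * d 0 ∧
    bdiff_dg^[6] d 6 = d 6 - 6 * d 5 + 15 * d 4 - 20 * d 3 + 15 * d 2 - 6 * d 1 + d 0 ∧
    bdiff_dg^[6] d 7 = d 7 - 6 * d 6 + 15 * d 5 - 20 * d 4 + 15 * d 3 - 6 * d 2 + d 1 := by
  simp only [Function.iterate_succ_apply', Function.iterate_zero_apply, bdiff_dg]
  refine ⟨?_, ?_, ?_, ?_, ?_, ?_, ?_, ?_⟩ <;> simp <;> ring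

/-- `Δ⁶d` at `n = m + 8` (plumbing). [folklore] -/
private theorem bdiff_six_add_eight_dg (d : ℕ → ℤ) (m : ℕ) :
    bdiff_dg^[6] d (m + 8) = d (m + 8) - 6 * d (m + 7) + 15 * d (m + 6) - 20 * d (m + 5) + 15 * d (m + 4)
      - 6 * d (m + 3) + d (m + 2) := by
  simp only [Function.iterate_succ_apply', Function.iterate_zero_apply, bdiff_dg]
  simp only [show m + 8 - 1 = m + 7 by omega, show m + 7 - 1 = m + 6 by omega, show m + 6 - 1 = m + 5 by omega,
    show m + 5 - 1 = m + 4 by omega, show m + 4 - 1 = m + 3 by omega, show m + 3 - 1 = m + 2 by omega,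
    Nat.add_eq_zero_iff, OfNat.ofNat_ne_zero, and_false, if_false]
  ring

/-- Coefficients of a numeral multiple in `ℤ⟦X⟧` (plumbing). [folklore] -/
private theorem coeff_ofNat_mul_dg (k n : ℕ) [k.AtLeastTwo] (φ : PowerSeries ℤ) :
    coeff n ((ofNat(k) : PowerSeries ℤ) * φ) = (OfNat.ofNat k : ℤ) * coeff n φ := by
  rw [← map_ofNat (C (R := ℤ)) k, coeff_C_mul]

/-- Generic slack-zero series: `d 0 = 0`, `d (m+1) = 1` ⟹ `(1 − X) · Σ d_k X^k = X` (plumbing). [folklore] -/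
private theorem gf_slack_zero_dg (d : ℕ → ℤ) (h0 : d 0 = 0) (h1 : ∀ m : ℕ, d (m + 1) = 1) :
    (1 - X : PowerSeries ℤ) * mk d = X := by
  rw [one_sub_X_mul_mk_dg]
  ext n
  rw [coeff_mk, PowerSeries.coeff_X (R := ℤ)]
  rcases n with _ | _ | m
  · simp [bdiff_zero_dg, h0]
  · simp [bdiff_succ_dg, h0, h1 0]
  · have e1 := h1 m
    have e2 := h1 (m + 1)
    simp only [bdiff_succ_dg, e2, e1]
    simp

/-- Generic slack-two series: a cubic from `k = 2` on, with `d 0 = 0`, `d 1 = 1` (plumbing). [folklore] -/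
private theorem gf_slack_two_dg (d : ℕ → ℤ) (h0 : d 0 = 0) (h1 : d 1 = 1)
    (h2 : ∀ m : ℕ, d (m + 2) = 2 + ∑ i ∈ range (m + 2), (i : ℤ) ^ 2) :
    (1 - X : PowerSeries ℤ) ^ 4 * mk d = X - X ^ 2 + X ^ 3 + 2 * X ^ 4 - X ^ 5 := by
  rw [one_sub_X_pow_mul_mk_dg]
  ext n
  simp only [map_add, map_sub, coeff_mk, coeff_ofNat_mul_dg, coeff_X_pow, PowerSeries.coeff_X (R := ℤ)]
  obtain ⟨e0, e1, e2, e3, e4, e5⟩ := bdiff_four_small_dg d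
  have d2 := h2 0
  have d3 := h2 1
  have d4 := h2 2
  have d5 := h2 3
  simp only [Finset.sum_range_succ, Finset.sum_range_zero] at d2 d3 d4 d5
  norm_num at d2 d3 d4 d5
  rcases n with _ | _ | _ | _ | _ | _ | m
  · rw [e0, h0]; simp
  · rw [e1, h0, h1]; simp
  · rw [e2, h0, h1, d2]; simp
  · rw [e3, h0, h1, d2, d3]; simp
  · rw [e4, h0, h1, d2, d3, d4]; simp
  · rw [e5, h1, d2, d3, d4, d5]; simp
  · rw [bdiff_four_add_six_dg]
    have hz : d (m + 6) - 4 * d (m + 5) + 6 * d (m + 4) - 4 * d (m + 3) + d (m + 2) = 0 := by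
      have q2 := h2 m
      have q3 := h2 (m + 1)
      have q4 := h2 (m + 2)
      have q5 := h2 (m + 3)
      have q6 := h2 (m + 4)
      simp only [Finset.sum_range_succ] at q2 q3 q4 q5 q6
      rw [q2, q3, q4, q5, q6]; push_cast; ring
    rw [hz]; simp

/-- Generic slack-four series: a quintic from `k = 2` on (given through `12·d`), with `d 0 = 0`, `d 1 = 3` (plumbing).
[folklore] -/
private theorem gf_slack_four_dg (d : ℕ → ℤ) (h0 : d 0 = 0) (h1 : d 1 = 3)
    (h2 : ∀ m : ℕ, 12 * d (m + 2) = 2 * (m : ℤ) ^ 5 + 9 * (m : ℤ) ^ 4 + 22 * (m : ℤ) ^ 3 + 81 * (m : ℤ) ^ 2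
      + 150 * (m : ℤ) + 132) :
    (1 - X : PowerSeries ℤ) ^ 6 * mk d
      = 3 * X - 7 * X ^ 2 + 12 * X ^ 3 + 2 * X ^ 4 + 10 * X ^ 5 + X ^ 6 - X ^ 7 := by
  rw [one_sub_X_pow_mul_mk_dg]
  ext n
  simp only [map_add, map_sub, coeff_mk, coeff_ofNat_mul_dg, coeff_X_pow, PowerSeries.coeff_X (R := ℤ)]
  obtain ⟨e0, e1, e2, e3, e4, e5, e6, e7⟩ := bdiff_six_small_dg d
  have d2 := h2 0
  have d3 := h2 1
  have d4 := h2 2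
  have d5 := h2 3
  have d6 := h2 4
  have d7 := h2 5
  norm_num at d2 d3 d4 d5 d6 d7
  rcases n with _ | _ | _ | _ | _ | _ | _ | _ | m
  · rw [e0, h0]; simp
  · rw [e1, h0, h1]; simp
  · rw [e2]; simp; omega
  · rw [e3]; simp; omega
  · rw [e4]; simp; omega
  · rw [e5]; simp; omega
  · rw [e6]; simp; omega
  · rw [e7]; simp; omega
  · rw [bdiff_six_add_eight_dg]
    have hz : 12 * (d (m + 8) - 6 * d (m + 7) + 15 * d (m + 6) - 20 * d (m + 5) + 15 * d (m + 4)
        - 6 * d (m + 3) + d (m + 2)) = 0 := by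
      have q2 := h2 m
      have q3 := h2 (m + 1)
      have q4 := h2 (m + 2)
      have q5 := h2 (m + 3)
      have q6 := h2 (m + 4)
      have q7 := h2 (m + 5)
      have q8 := h2 (m + 6)
      push_cast at q2 q3 q4 q5 q6 q7 q8
      linear_combination q8 - 6 * q7 + 15 * q6 - 20 * q5 + 15 * q4 - 6 * q3 + q2
    have hz' : d (m + 8) - 6 * d (m + 7) + 15 * d (m + 6) - 20 * d (m + 5) + 15 * d (m + 4)
        - 6 * d (m + 3) + d (m + 2) = 0 := by
      clear e0 e1 e2 e3 e4 e5 e6 e7 d2 d3 d4 d5 d6 d7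
      omega
    rw [hz']; simp

/-! ## The three diagonal series -/

/-- **`(1 − X) · D₀ = X`**: the tight diagonal `N(6k, k) = 1` (`k ≥ 1`) of the surface renewal table, as the series
`D₀ = X + X² + X³ + ⋯ = X/(1 − X)`. OURS.
[cite: MadrasSlade1993, §4.2, (4.2.2), remark before (4.2.21) (p. 94)] [cite: EntingJensen2009, §7.4.2, Fig. 7.10] -/
theorem one_sub_X_mul_slackDiagSeries_zero : (1 - X : PowerSeries ℤ) * slackDiagSeries 0 = X :=
  gf_slack_zero_dg _ (by simp [slackDiagCount_zero_right]) fun m => by simp [slackDiagCount_zero_succ]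

/-- **`(1 − X)⁴ · D₁ = X − X² + X³ + 2X⁴ − X⁵`**: the slack-two diagonal `N(6k+2, k) = 0, 1, 3, 7, 16, 32, 57, 93, …`
of the surface renewal table is rational with a single pole, of order four, at `X = 1`. OURS.
[cite: MadrasSlade1993, §4.2, (4.2.2), remark before (4.2.21) (p. 94)] [cite: EntingJensen2009, §7.4.2, Fig. 7.10] -/
theorem one_sub_X_pow_four_mul_slackDiagSeries_one :
    (1 - X : PowerSeries ℤ) ^ 4 * slackDiagSeries 1 = X - X ^ 2 + X ^ 3 + 2 * X ^ 4 - X ^ 5 :=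
  gf_slack_two_dg _ (by simp [slackDiagCount_zero_right]) (by simp [slackDiagCount_one_one])
    fun m => by exact_mod_cast slackDiagCount_one_add_two m

/-- ★ **`(1 − X)⁶ · D₂ = 3X − 7X² + 12X³ + 2X⁴ + 10X⁵ + X⁶ − X⁷`**: the slack-four diagonal
`N(6k+4, k) = 0, 3, 11, 33, 95, 260, 649, 1461, 2993, …` of the surface renewal table is rational with a single pole,
of order six, at `X = 1` — the generating-function form of the slack-four law. OURS.
[cite: MadrasSlade1993, §4.2, (4.2.2), remark before (4.2.21) (p. 94)] [cite: EntingJensen2009, §7.4.2, Fig. 7.10]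
[cite: BeatonBousquetMelouDeGierDuminilCopinGuttmann2014, §3.1] -/
theorem one_sub_X_pow_six_mul_slackDiagSeries_two :
    (1 - X : PowerSeries ℤ) ^ 6 * slackDiagSeries 2
      = 3 * X - 7 * X ^ 2 + 12 * X ^ 3 + 2 * X ^ 4 + 10 * X ^ 5 + X ^ 6 - X ^ 7 :=
  gf_slack_four_dg _ (by simp [slackDiagCount_zero_right]) (by simp [slackDiagCount_two_one])
    fun m => by exact_mod_cast twelve_mul_slackDiagCount_two_add_two m

/-- `D₀ = (1 + X + X² + ⋯) · X`. OURS. [cite: MadrasSlade1993, §4.2, (4.2.2)] -/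
theorem slackDiagSeries_zero_eq : slackDiagSeries 0 = (mk 1 : PowerSeries ℤ) * X := by
  rw [← one_sub_X_mul_slackDiagSeries_zero, ← mul_assoc, mk_one_mul_one_sub_eq_one, one_mul]

/-- `D₁ = (1 + X + X² + ⋯)⁴ · (X − X² + X³ + 2X⁴ − X⁵)`. OURS. [cite: MadrasSlade1993, §4.2, (4.2.2)] -/
theorem slackDiagSeries_one_eq :
    slackDiagSeries 1 = (mk 1 : PowerSeries ℤ) ^ 4 * (X - X ^ 2 + X ^ 3 + 2 * X ^ 4 - X ^ 5) := by
  rw [← one_sub_X_pow_four_mul_slackDiagSeries_one, ← mul_assoc, ← mul_pow, mk_one_mul_one_sub_eq_one, one_pow,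
    one_mul]

/-- ★ `D₂ = (1 + X + X² + ⋯)⁶ · (3X − 7X² + 12X³ + 2X⁴ + 10X⁵ + X⁶ − X⁷)`, i.e.
`N(6k+4, k) = Σ_i ν_i · C(k − i + 5, 5)` with `ν = (0, 3, −7, 12, 2, 10, 1, −1)`. OURS.
[cite: MadrasSlade1993, §4.2, (4.2.2)] [cite: EntingJensen2009, §7.4.2, Fig. 7.10] -/
theorem slackDiagSeries_two_eq :
    slackDiagSeries 2
      = (mk 1 : PowerSeries ℤ) ^ 6 * (3 * X - 7 * X ^ 2 + 12 * X ^ 3 + 2 * X ^ 4 + 10 * X ^ 5 + X ^ 6 - X ^ 7) := by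
  rw [← one_sub_X_pow_six_mul_slackDiagSeries_two, ← mul_assoc, ← mul_pow, mk_one_mul_one_sub_eq_one, one_pow,
    one_mul]

end Series

/-! ## Diagonal polynomiality for `j ≤ 2` (Kauers–Paule vocabulary) -/

section PolySeq

open Polynomial Literature.Combinatorics.Enumerative.PolynomialSequenceGeneratingFunction

/-- `6 · Σ_{i<m+2} i² = (m+1)(m+2)(2m+3)` (plumbing). [folklore] -/
private theorem six_mul_sum_range_sq_dg (m : ℕ) :
    6 * ∑ i ∈ range (m + 2), i ^ 2 = (m + 1) * (m + 2) * (2 * m + 3) := by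
  induction m with
  | zero => simp [sum_range_succ]
  | succ m ih =>
    rw [sum_range_succ, mul_add, ih]
    ring

/-- The tight diagonal from `k = 1` on is the polynomial sequence `1` of degree `0`:
`k ↦ N(6(k+1), k+1) = 1`. OURS.
[cite: KauersPaule2011, Sect. 3.2; MadrasSlade1993, §4.2, (4.2.2)] -/
theorem isPolySeqOfDegree_slackDiagCount_zero_succ :
    IsPolySeqOfDegree 0 (fun k : ℕ => (slackDiagCount 0 (k + 1) : ℚ)) := by
  refine ⟨1, by simp, fun k => ?_⟩
  simp [slackDiagCount_zero_succ]

/-- DIAGONAL POLYNOMIALITY at slack two: from `k = 2` on the slack-two diagonal is a polynomial sequence of degree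
exactly `3`: `N(6(k+2)+2, k+2) = (2k³ + 9k² + 13k + 18)/6`. OURS.
[cite: KauersPaule2011, Sect. 3.2; MadrasSlade1993, §4.2, (4.2.2)] -/
theorem isPolySeqOfDegree_slackDiagCount_one_add_two :
    IsPolySeqOfDegree 3 (fun k : ℕ => (slackDiagCount 1 (k + 2) : ℚ)) := by
  refine ⟨C (1 / 6 : ℚ) * (2 * X ^ 3 + 9 * X ^ 2 + 13 * X + 18), ?_, fun k => ?_⟩
  · compute_degree!
  · have h : 6 * slackDiagCount 1 (k + 2) = 2 * k ^ 3 + 9 * k ^ 2 + 13 * k + 18 := by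
      rw [slackDiagCount_one_add_two, mul_add, six_mul_sum_range_sq_dg]
      ring
    have h' : (6 : ℚ) * (slackDiagCount 1 (k + 2) : ℚ)
        = 2 * (k : ℚ) ^ 3 + 9 * (k : ℚ) ^ 2 + 13 * (k : ℚ) + 18 := by
      exact_mod_cast h
    simp only [eval_mul, eval_C, eval_add, eval_pow, eval_X, eval_ofNat]
    linarith

/-- ★ DIAGONAL POLYNOMIALITY at slack four: from `k = 2` on the slack-four diagonal is a polynomial sequence of
degree exactly `5`: `N(6(k+2)+4, k+2) = (2k⁵ + 9k⁴ + 22k³ + 81k² + 150k + 132)/12` (leading coefficient `1/6`).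
Consequently `Literature.Combinatorics.Enumerative.PolynomialSequenceGeneratingFunction.kp_thm_3_1` applies to the
shifted diagonal `k ↦ N(6k+16, k+2)`. OURS.
[cite: KauersPaule2011, Theorem 3.1 (Sect. 3.2); MadrasSlade1993, §4.2, (4.2.2)] -/
theorem isPolySeqOfDegree_slackDiagCount_two_add_two :
    IsPolySeqOfDegree 5 (fun k : ℕ => (slackDiagCount 2 (k + 2) : ℚ)) := by
  refine ⟨C (1 / 12 : ℚ) * (2 * X ^ 5 + 9 * X ^ 4 + 22 * X ^ 3 + 81 * X ^ 2 + 150 * X + 132), ?_,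
    fun k => ?_⟩
  · compute_degree!
  · have h' : (12 : ℚ) * (slackDiagCount 2 (k + 2) : ℚ)
        = 2 * (k : ℚ) ^ 5 + 9 * (k : ℚ) ^ 4 + 22 * (k : ℚ) ^ 3 + 81 * (k : ℚ) ^ 2 + 150 * (k : ℚ) + 132 := by
      exact_mod_cast twelve_mul_slackDiagCount_two_add_two k
    simp only [eval_mul, eval_C, eval_add, eval_pow, eval_X, eval_ofNat]
    linarith

end PolySeq

end Literature.Probability.RandomPlanarGeometry.SAW.HexBW.Wall
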